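import Summits.QuantumFields.YangMills.Theorems.FibreConvexityTailDefs
import Literature.MathematicalPhysics.QuantumFieldTheory.Balaban1983to89.T3Thresholds
import Literature.MathematicalPhysics.QuantumFieldTheory.Balaban1983to89.T4PairDerivBridge

/-!
# Route `FibreConvexityTail` — crux `TwoSidedTailL` (stmt-QuantumFields-25567), registered stub `stub_chernoffOnEvent` (S2, «Chernoff on the
# event»), PROVED: a sub-Gaussian moment bound on the two-sided event gives its Gibbs mass in the crux's per-plaquette currency

The line of crux `TwoSidedTailL` (BC3 skeleton `TwoSidedTailL_birth.lean`, planner ym-r3-idea-2 g0) composes `TwoSidedTailL` from S1 = `stub_fibreMGF`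
(the fibre-convexity lever, XL, NOT touched here) and S2 = `stub_chernoffOnEvent` (M).  THIS FILE proves S2 exactly as registered, against the
definitions `twoSidedEvent` / `SubGaussianOnEvent` of `…FibreConvexityTailDefs`:

  `∀ F γ b₀ p₀, 0 < γ → 0 < b₀ → ∀ K j a M σ, 0 ≤ M → 0 < σ → SubGaussianOnEvent F γ b₀ p₀ K j a M σ →`
  `Gibbs_K(twoSidedEvent F γ b₀ p₀ K j a) ≤ M·β_{K−j}^0·exp(−(9/(32σ²))·p(g_{K−j})²)`.

THE ARGUMENT (§2).  Write `g = g_{K−j} = √(γL^{−(K−j)}) > 0`, `p = p(g) = B10.pFun b₀ p₀ g`, so `θ(K−j) = g·p` (`T3Thresholds.θBal_eq`).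
* `p ≥ 0`: on the event `θ(K−j) ≤ |Ū^{j}(∂a) − 1|`, i.e. `p ≤ X := |Ū^{j}(∂a) − 1|/g`; Chernoff for the RESTRICTED measure `ν = Gibbs_K|event`
  (Mathlib `ProbabilityTheory.measure_ge_le_exp_mul_mgf`; `e^{tX}` is `ν`-integrable because `0 ≤ |·−1| ≤ 2` on `SU(2)`):
  `Gibbs_K(event) = ν{p ≤ X} ≤ e^{−tp}·mgf_ν(X)(t) ≤ M·e^{−tp + tp/4 + σ²t²/2}`, and `t = 3p/(4σ²) ≥ 0` gives the exponent `−9p²/(32σ²)`.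
* `p < 0` (possible only for `g > e`, i.e. a coupling `γ > 1` the crux never uses, since the stub is registered for every `γ > 0`): then the conditioner's
  threshold `θ(K−j−2) = g'·p(g')` with `g' = g_{K−j−2} ≥ g` is NEGATIVE too (§1 `pFun_neg_mono`: `p(g) = b₀(1 + log g⁻¹)^{p₀} < 0` forces a negative base
  and `cos(p₀π) < 0`, both inherited by the smaller base at `g'`), so `PlaqSmall θ(K−j−2) (Ū^{j+2})` fails at any plaquette and the event is EMPTY.

HONEST SCOPE.  S1 (`stub_fibreMGF`), the crux `TwoSidedTailL`, the route and the rung R3 stay open; nothing here bears on the Yang–Mills mass gap (R3 is a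
record rung, not the Clay statement).  References: T. Bałaban, CMP 102 (1985) 255–275 [Balaban1985UV3] ((3) p.256, (7) p.257).
-/

noncomputable section

open MeasureTheory ProbabilityTheory Real
open Literature.MathematicalPhysics.QuantumFieldTheory.Balaban1983to89
open Literature.MathematicalPhysics.QuantumFieldTheory.Balaban1983to89.Missing
open Literature.MathematicalPhysics.QuantumFieldTheory.Balaban1983to89.T4Continuum
open Literature.MathematicalPhysics.QuantumFieldTheory.Balaban1983to89.T3ContinuumYM3Torus
open Literature.MathematicalPhysics.QuantumFieldTheory.Balaban1983to89.T3UnitScaleTilt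
open Literature.MathematicalPhysics.QuantumFieldTheory.Balaban1983to89.T3UnitLawDensityEML (ℰp measurableE_ℰp)
open Literature.MathematicalPhysics.QuantumFieldTheory.Balaban1983to89.T3Thresholds
open Literature.MathematicalPhysics.QuantumFieldTheory.Balaban1983to89.T3ThresholdSmallness (sqrt_coupling_pos_le)
open Literature.MathematicalPhysics.QuantumFieldTheory.Balaban1983to89.T4PairDerivBridge (dist1_le_two_specialUnitaryGroup)

namespace Summit.QuantumFields.YangMills.Theorems.FibreConvexityTail

namespace ChernoffOnEvent

/-! ## §1 Two scalar lemmas: sign propagation of `p(g)` and the Chernoff exponent -/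

/-- **SIGN PROPAGATION OF BAŁABAN'S EXPONENT `p(g) = b₀(1 + log g⁻¹)^{p₀}`** (`b₀ > 0`, real power): if `p(g) < 0` for some `g > 0` then `p(g') < 0`
for every `g' ≥ g` — a negative real power forces a negative base `1 + log g⁻¹ < 0` and `cos(p₀π) < 0` (`Real.rpow_def_of_neg`), and the base only
decreases as `g` grows.  (For `g ≤ 1` the base is `≥ 1` and `p ≥ 0`, `B10.pFun_nonneg`; the lemma only matters at couplings `γ > 1`.) -/
theorem pFun_neg_mono {b₀ p₀ g g' : ℝ} (hb₀ : 0 < b₀) (hg : 0 < g) (hgg' : g ≤ g') (hp : B10.pFun b₀ p₀ g < 0) :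
    B10.pFun b₀ p₀ g' < 0 := by
  unfold B10.pFun at hp ⊢
  have h1 : (1 + Real.log g⁻¹) ^ p₀ < 0 := by
    by_contra h
    exact absurd hp (not_lt.mpr (mul_nonneg hb₀.le (not_lt.mp h)))
  have hbase : 1 + Real.log g⁻¹ < 0 := by
    by_contra h
    exact absurd h1 (not_lt.mpr (Real.rpow_nonneg (not_lt.mp h) p₀))
  have hcos : Real.cos (p₀ * Real.pi) < 0 := by
    rw [Real.rpow_def_of_neg hbase] at h1
    rcases mul_neg_iff.mp h1 with ⟨-, h⟩ | ⟨h, -⟩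
    · exact h
    · exact absurd h (not_lt.mpr (Real.exp_pos _).le)
  have hbase' : 1 + Real.log g'⁻¹ < 0 := by
    have : Real.log g'⁻¹ ≤ Real.log g⁻¹ :=
      Real.log_le_log (inv_pos.mpr (hg.trans_le hgg')) (inv_anti₀ hg hgg')
    linarith
  rw [Real.rpow_def_of_neg hbase']
  exact mul_neg_of_pos_of_neg hb₀ (mul_neg_of_pos_of_neg (Real.exp_pos _) hcos)

/-- The Chernoff exponent at the optimal parameter: with `t = 3p/(4σ²)`, `−t·p + (t·(p/4) + σ²t²/2) = −(9/(32σ²))·p²`. -/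
theorem chernoff_exponent {σ : ℝ} (hσ : 0 < σ) (p : ℝ) :
    -(3 * p / (4 * σ ^ 2)) * p + (3 * p / (4 * σ ^ 2) * (p / 4) + σ ^ 2 * (3 * p / (4 * σ ^ 2)) ^ 2 / 2) =
      -(9 / (32 * σ ^ 2) * p ^ 2) := by
  have hσ2 : σ ^ 2 ≠ 0 := by positivity
  field_simp
  ring

/-! ## §2 Chernoff on an event for a bounded observable -/

variable {Ω : Type*} [MeasurableSpace Ω]

/-- **CHERNOFF ON AN EVENT**: `μ` finite, `X` measurable with `0 ≤ X ≤ B`, an event `E ⊆ {p ≤ X}` with `p ≥ 0`, and the restricted moment bound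
`mgf_{μ|E}(X)(t) ≤ M·exp(t·(p/4) + σ²t²/2)` for all `t ≥ 0` ⇒ `μ(E) ≤ M·exp(−(9/(32σ²))·p²)` (Mathlib's `measure_ge_le_exp_mul_mgf` for `μ|E` at
`t = 3p/(4σ²)`; boundedness makes `e^{tX}` integrable). [folklore] -/
theorem measureReal_le_of_mgf_restrict_le (μ : Measure Ω) [IsFiniteMeasure μ] {X : Ω → ℝ} (hXm : Measurable X) {B : ℝ}
    (hX : ∀ ω, 0 ≤ X ω ∧ X ω ≤ B) {E : Set Ω} {p : ℝ} (hp : 0 ≤ p) (hE : E ⊆ {ω | p ≤ X ω}) {M σ : ℝ} (hσ : 0 < σ)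
    (hmgf : ∀ t : ℝ, 0 ≤ t → mgf X (μ.restrict E) t ≤ M * Real.exp (t * (p / 4) + σ ^ 2 * t ^ 2 / 2)) :
    μ.real E ≤ M * Real.exp (-(9 / (32 * σ ^ 2) * p ^ 2)) := by
  set t : ℝ := 3 * p / (4 * σ ^ 2) with ht
  have ht0 : 0 ≤ t := by positivity
  -- integrability of `e^{tX}` under the restricted measure (bounded measurable)
  have hint : Integrable (fun ω => Real.exp (t * X ω)) (μ.restrict E) := by
    refine (integrable_const (Real.exp (t * B))).mono' ((measurable_exp.comp (hXm.const_mul t)).aestronglyMeasurable)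
      (ae_of_all _ fun ω => ?_)
    rw [Real.norm_eq_abs, abs_of_pos (Real.exp_pos _)]
    exact Real.exp_le_exp.mpr (mul_le_mul_of_nonneg_left (hX ω).2 ht0)
  -- Chernoff for `μ|E`: the event `{p ≤ X}` has full restricted mass `μ(E)`
  have hch := measure_ge_le_exp_mul_mgf (μ := μ.restrict E) (X := X) p ht0 hint
  have hset : (μ.restrict E).real {ω | p ≤ X ω} = μ.real E := by
    rw [measureReal_restrict_apply (measurableSet_le measurable_const hXm), Set.inter_eq_right.mpr hE]
  rw [hset] at hch
  refine hch.trans ?_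
  calc Real.exp (-t * p) * mgf X (μ.restrict E) t
      ≤ Real.exp (-t * p) * (M * Real.exp (t * (p / 4) + σ ^ 2 * t ^ 2 / 2)) :=
        mul_le_mul_of_nonneg_left (hmgf t ht0) (Real.exp_pos _).le
    _ = M * (Real.exp (-t * p) * Real.exp (t * (p / 4) + σ ^ 2 * t ^ 2 / 2)) := by ring
    _ = M * Real.exp (-t * p + (t * (p / 4) + σ ^ 2 * t ^ 2 / 2)) := by rw [← Real.exp_add]
    _ = M * Real.exp (-(9 / (32 * σ ^ 2) * p ^ 2)) := by rw [ht, chernoff_exponent hσ p]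

end ChernoffOnEvent

open ChernoffOnEvent

/-! ## §3 The interface is monotone in the event: a moment bound on any WINDOW containing the two-sided event suffices -/

/-- **WINDOW VERSION ⇒ `SubGaussianOnEvent`**: the integrand `exp(t·|Ū^{j}(∂a) − 1|/g_{K−j})` is positive and bounded (`|·−1| ≤ 2` on `SU(2)`), so a
moment bound under the Gibbs measure restricted to ANY event `W ⊇ twoSidedEvent …` (e.g. the hierarchically-small window `{∀ i < j small} ∩
{conditioner small}` on which Herbst is run, without the tail condition) gives the registered interface on the two-sided event itself. -/
theorem subGaussianOnEvent_of_superset (F : T3Family) {γ : ℝ} (hγ : 0 < γ) (b₀ p₀ : ℝ) (K j : ℕ) (a : Plaq (F.P K) j) {M σ : ℝ}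
    {W : Set (GaugeField (F.P K) 0 (Matrix.specialUnitaryGroup (Fin 2) ℂ))} (hW : twoSidedEvent F γ b₀ p₀ K j a ⊆ W)
    (h : ∀ t : ℝ, 0 ≤ t →
      mgf (fun U => GaugeGroup.dist1 (GaugeField.plaqHol
            (Averaging.iter (fun i' => BlockAveraging.blockAvg (P := F.P K) (j := i') ℰp) j U) a) /
          Real.sqrt (γ * ((F.L : ℝ)⁻¹) ^ (K - j)))
        ((gibbsK F ℰp γ K).restrict W) t ≤
      M * Real.exp (t * (B10.pFun b₀ p₀ (Real.sqrt (γ * ((F.L : ℝ)⁻¹) ^ (K - j))) / 4) + σ ^ 2 * t ^ 2 / 2)) :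
    SubGaussianOnEvent F γ b₀ p₀ K j a M σ := by
  intro t ht
  haveI := isProbabilityMeasure_gibbsK F ℰp hγ.le K
  have hg0 : 0 < Real.sqrt (γ * ((F.L : ℝ)⁻¹) ^ (K - j)) := (sqrt_coupling_pos_le F.hL.2.le hγ (K - j)).1
  refine le_trans ?_ (h t ht)
  -- `mgf` under the restricted measures is the set integral of the positive bounded integrand: monotone in the set
  show ∫ U in twoSidedEvent F γ b₀ p₀ K j a, Real.exp (t * (GaugeGroup.dist1 (GaugeField.plaqHol
      (Averaging.iter (fun i' => BlockAveraging.blockAvg (P := F.P K) (j := i') ℰp) j U) a) /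
        Real.sqrt (γ * ((F.L : ℝ)⁻¹) ^ (K - j)))) ∂(gibbsK F ℰp γ K) ≤
    ∫ U in W, Real.exp (t * (GaugeGroup.dist1 (GaugeField.plaqHol
      (Averaging.iter (fun i' => BlockAveraging.blockAvg (P := F.P K) (j := i') ℰp) j U) a) /
        Real.sqrt (γ * ((F.L : ℝ)⁻¹) ^ (K - j)))) ∂(gibbsK F ℰp γ K)
  have hmeas : Measurable fun U : GaugeField (F.P K) 0 (Matrix.specialUnitaryGroup (Fin 2) ℂ) =>
      Real.exp (t * (GaugeGroup.dist1 (GaugeField.plaqHol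
        (Averaging.iter (fun i' => BlockAveraging.blockAvg (P := F.P K) (j := i') ℰp) j U) a) /
          Real.sqrt (γ * ((F.L : ℝ)⁻¹) ^ (K - j)))) :=
    measurable_exp.comp (((measurable_dist1_plaqHol_iter F K j a).div_const _).const_mul t)
  refine setIntegral_mono_set ?_ (ae_of_all _ fun U => (Real.exp_pos _).le) (ae_of_all _ hW)
  refine (integrable_const (Real.exp (t * (2 / Real.sqrt (γ * ((F.L : ℝ)⁻¹) ^ (K - j)))))).mono'
    hmeas.aestronglyMeasurable (ae_of_all _ fun U => ?_)
  rw [Real.norm_eq_abs, abs_of_pos (Real.exp_pos _)]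
  exact Real.exp_le_exp.mpr (mul_le_mul_of_nonneg_left
    (div_le_div_of_nonneg_right (dist1_le_two_specialUnitaryGroup _) hg0.le) ht)

/-! ## §4 The registered stub -/

/-- **STUB `stub_chernoffOnEvent` (S2) of the line of crux `TwoSidedTailL` (stmt-QuantumFields-25567), exactly as registered** — CHERNOFF ON THE
TWO-SIDED EVENT: for every family, every coupling `γ > 0`, profile `b₀ > 0`, `p₀`, cut-off `K`, height `j`, level-`j` plaquette `a` and constants
`M ≥ 0`, `σ > 0`, the sub-Gaussian moment bound on the two-sided event (`SubGaussianOnEvent`, the interface stub `stub_fibreMGF` must deliver) gives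
`Gibbs_K(twoSidedEvent F γ b₀ p₀ K j a) ≤ M·β_{K−j}^0·exp(−(9/(32σ²))·p(g_{K−j})²)` — the crux's per-plaquette currency with `C = M`, `A = 0`,
`c = 9/(32σ²)`.  Case `p(g_{K−j}) ≥ 0`: Chernoff at `t = 3p/(4σ²)` (§2); case `p < 0` (only for `γ > 1`): the conditioner's threshold is negative
too (`pFun_neg_mono`, `g_{K−j−2} ≥ g_{K−j}`), so the event is empty.  S1, the crux and the rung stay open. -/
theorem stub_chernoffOnEvent : ∀ (F : T3Family) (γ b₀ p₀ : ℝ), 0 < γ → 0 < b₀ → ∀ (K j : ℕ) (a : Plaq (F.P K) j) (M σ : ℝ), 0 ≤ M → 0 < σ → SubGaussianOnEvent F γ b₀ p₀ K j a M σ → (T3UnitScaleTilt.gibbsK F T3UnitLawDensityEML.ℰp γ K).real (twoSidedEvent F γ b₀ p₀ K j a) ≤ M * (F.scheme T3UnitLawDensityEML.ℰp γ).β (K - j) ^ (0 : ℕ) * Real.exp (-(9 / (32 * σ ^ 2) * B10.pFun b₀ p₀ (Real.sqrt (γ * ((F.L : ℝ)⁻¹) ^ (K - j))) ^ 2)) :=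 by
  intro F γ b₀ p₀ hγ hb₀ K j a M σ hM hσ hsub
  rw [pow_zero, mul_one]
  haveI := isProbabilityMeasure_gibbsK F ℰp hγ.le K
  have hL : 1 ≤ F.L := F.hL.2.le
  have hg0 : 0 < Real.sqrt (γ * ((F.L : ℝ)⁻¹) ^ (K - j)) := (sqrt_coupling_pos_le hL hγ (K - j)).1
  rcases lt_or_ge (B10.pFun b₀ p₀ (Real.sqrt (γ * ((F.L : ℝ)⁻¹) ^ (K - j)))) 0 with hpneg | hp0
  · -- degenerate case `p < 0`: the conditioner's threshold is negative as well, so the two-sided event is empty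
    have hg' : Real.sqrt (γ * ((F.L : ℝ)⁻¹) ^ (K - j)) ≤ Real.sqrt (γ * ((F.L : ℝ)⁻¹) ^ (K - (j + 2))) :=
      coupling_le_of_le hL hγ.le (by omega)
    have hθneg : θBal F.L γ b₀ p₀ (K - (j + 2)) < 0 := by
      rw [θBal_eq]
      exact mul_neg_of_pos_of_neg (sqrt_coupling_pos_le hL hγ (K - (j + 2))).1 (pFun_neg_mono hb₀ hg0 hg' hpneg)
    have hempty : twoSidedEvent F γ b₀ p₀ K j a = ∅ := by
      refine Set.eq_empty_iff_forall_notMem.mpr fun U hU => ?_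
      have hd : 0 < (F.P K).d := by rw [T3Family.P_d]; norm_num
      have hd1 : 1 < (F.P K).d := by rw [T3Family.P_d]; norm_num
      let q : Plaq (F.P K) (j + 2) := ⟨default, ⟨0, hd⟩, ⟨1, hd1⟩, Nat.zero_lt_one⟩
      have hq := (plaqSmall_conditioner_of_mem_twoSidedEvent hU) q
      exact absurd (hq.trans hθneg) (not_lt.mpr (GaugeGroup.dist1_nonneg _))
    rw [hempty, measureReal_empty]
    positivity
  · -- Chernoff on the event
    refine measureReal_le_of_mgf_restrict_le (gibbsK F ℰp γ K)
      ((measurable_dist1_plaqHol_iter F K j a).div_const _) (B := 2 / Real.sqrt (γ * ((F.L : ℝ)⁻¹) ^ (K - j)))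
      (fun U => ⟨div_nonneg (GaugeGroup.dist1_nonneg _) hg0.le,
        div_le_div_of_nonneg_right (dist1_le_two_specialUnitaryGroup _) hg0.le⟩)
      hp0 (fun U hU => ?_) hσ hsub
    -- on the event: `θ(K−j) = g·p ≤ |Ū^{j}(∂a) − 1|`, i.e. `p ≤ |Ū^{j}(∂a) − 1| / g`
    have h1 := twoSidedEvent_subset_tail F γ b₀ p₀ K j a hU
    simp only [Set.mem_setOf_eq] at h1 ⊢
    rw [θBal_eq] at h1
    rw [le_div_iff₀ hg0]
    linarith

end Summit.QuantumFields.YangMills.Theorems.FibreConvexityTail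

end
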